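import HarnessLib
import Summits.RiemannHypothesis.RiemannHypothesis.Theorems.SignConePointwiseCheckerFastSound
import Summits.RiemannHypothesis.RiemannHypothesis.Theorems.SignConePointwiseSOSTailBound

/-!
# Route SignCone: the pointwise checker with an out-of-window correction `H` (Dirichlet-SOS tails)

Support for the unconditional rungs of `SignConeOscillatory` / `SignConeInequality`
(items stmt-RiemannHypothesis-16302 / 16301). The fast checker of `SignConePointwiseCheckerFast.lean`
certifies `F_D ≥ 0` up to `Y₀` and closes the tail with `cos ≤ 1`, which forces `Y₀ ≈ 2·exp(Σ a_n)`.
Here the density is `F_D + H` with `H(y) = Σ_t c_t cos(y (log p_t − log q_t))` a finite list of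
corrections whose frequencies lie OUTSIDE the window (`|log p − log q| > L = 2b`, so they pair to zero
with every autocorrelation supported in `[-2b, 2b]`), and the tail is closed with the Dirichlet-SOS bound
`comb − H ≤ sosBound` of `SignConePointwiseSOSTailBound.lean` when `H = Hsos` of an `SOSData`.

* `HTerm`, `Hval`, `PW.HFI` (enclosure of `H(u)`), `PW.HlipQ` (Lipschitz constant of `H`);
* `PWData.flTH / checkGridFromH / checkGrid₂H / checkAGrid₂H / checkHTerms / checkTailH` and
  `SOSData.hlist` (the correction read off the certificate, `Hval Z.hlist = Z.Hsos`);
* soundness: `point_boundH`, `gridFromH_sound`, `agrid₂H_sound`, `chain₂H_sound`, `tailH_sound` and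
  **`PWData.F_add_Hsos_nonneg_of_checks`**: `∀ y, 0 ≤ F_D(y) + Z.Hsos y`.
-/

noncomputable section

-- `Summit.RiemannHypothesis.RiemannHypothesis.…` repeats a namespace component by design (D-0017 layout).
set_option linter.dupNamespace false

open Real

namespace Summit.RiemannHypothesis.RiemannHypothesis.Theorems.SignCone

open Literature.Analysis.ValidatedNumerics.Numerics Literature.NumberTheory.LFunctions
open Literature.Analysis.SpecialFunctions (reDigammaQuarter reDigammaQuarter_mono reDigammaQuarter_even)

/-! ## Correction terms -/

/-- A correction term `c · cos(y (log p − log q))`. [folklore] -/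
structure HTerm where
  /-- numerator of the ratio -/
  p : ℕ
  /-- denominator of the ratio -/
  q : ℕ
  /-- coefficient -/
  c : ℚ
  deriving DecidableEq

/-- `H(y) = Σ_t c_t cos(y (log p_t − log q_t))`. [folklore] -/
def Hval (hl : List HTerm) (y : ℝ) : ℝ :=
  (hl.map fun t => (t.c : ℝ) * Real.cos (y * (Real.log t.p - Real.log t.q))).sum

/-- `H` is even. [folklore] -/
theorem Hval_neg (hl : List HTerm) (y : ℝ) : Hval hl (-y) = Hval hl y := by
  unfold Hval; congr 1; refine List.map_congr_left fun t _ => ?_; rw [neg_mul, Real.cos_neg]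

namespace PW

/-- Enclosure of `H(u)` with the logarithms read from the table `logs`. [folklore] -/
def HFI (hl : List HTerm) (logs : List FI) (u : ℚ) : FI :=
  hl.foldr (fun t acc => ((FI.ofRat t.c).mul
    (FI.cosSin ((FI.ofRat u).mul ((logs.getD t.p (FI.ofInt 0)).sub (logs.getD t.q (FI.ofInt 0))))).1).add acc)
    (FI.ofInt 0)

/-- `H(u) ∈ HFI hl (logTable N) u` when all `p, q ≤ N`. [folklore] -/
theorem mem_HFI {N : ℕ} (hok : FI.logTableOK N = true) :
    ∀ (hl : List HTerm), (∀ t ∈ hl, t.p ≤ N ∧ t.q ≤ N) → ∀ u : ℚ,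
      FI.mem (Hval hl u) (HFI hl (FI.logTable N) u)
  | [], _, u => by simpa [Hval, HFI] using FI.mem_ofInt 0
  | t :: rest, hl, u => by
    have ht := hl t (by simp)
    have ih := mem_HFI hok rest (fun s hs => hl s (by simp [hs])) u
    unfold Hval at ih ⊢
    rw [List.map_cons, List.sum_cons]
    show FI.mem _ (((FI.ofRat t.c).mul
      (FI.cosSin ((FI.ofRat u).mul (((FI.logTable N).getD t.p (FI.ofInt 0)).sub
        ((FI.logTable N).getD t.q (FI.ofInt 0))))).1).add (HFI rest (FI.logTable N) u))
    refine FI.mem_add (FI.mem_mul (FI.mem_ofRat t.c) ?_) ih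
    have hθ : FI.mem ((u : ℝ) * (Real.log t.p - Real.log t.q))
        ((FI.ofRat u).mul (((FI.logTable N).getD t.p (FI.ofInt 0)).sub ((FI.logTable N).getD t.q (FI.ofInt 0)))) :=
      FI.mem_mul (FI.mem_ofRat u) (FI.mem_sub (FI.mem_logTable hok ht.1) (FI.mem_logTable hok ht.2))
    exact (FI.mem_cosSin hθ).1

/-- Upper bound of the Lipschitz constant of `H`: `Σ_t |c_t| (log⁺ p_t + log⁺ q_t)`. [folklore] -/
def HlipQ (logs : List FI) : List HTerm → ℚ
  | [] => 0
  | t :: rest => |t.c| * ((logs.getD t.p (FI.ofInt 0)).hiQ + (logs.getD t.q (FI.ofInt 0)).hiQ) + HlipQ logs rest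

/-- `0 ≤ HlipQ` for a genuine log table and indices `≥ 1`. [folklore] -/
theorem HlipQ_nonneg {N : ℕ} (hok : FI.logTableOK N = true) :
    ∀ (hl : List HTerm), (∀ t ∈ hl, (1 ≤ t.p ∧ t.p ≤ N) ∧ (1 ≤ t.q ∧ t.q ≤ N)) →
      (0 : ℝ) ≤ HlipQ (FI.logTable N) hl
  | [], _ => by simp [HlipQ]
  | t :: rest, hl => by
    have ht := hl t (by simp)
    have ih := HlipQ_nonneg hok rest (fun s hs => hl s (by simp [hs]))
    have hp1 : Real.log t.p ≤ (((FI.logTable N).getD t.p (FI.ofInt 0)).hiQ : ℝ) :=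
      FI.le_hiQ (FI.mem_logTable hok ht.1.2)
    have hq1 : Real.log t.q ≤ (((FI.logTable N).getD t.q (FI.ofInt 0)).hiQ : ℝ) :=
      FI.le_hiQ (FI.mem_logTable hok ht.2.2)
    have hp0 : 0 ≤ Real.log t.p := Real.log_nonneg (by exact_mod_cast ht.1.1)
    have hq0 : 0 ≤ Real.log t.q := Real.log_nonneg (by exact_mod_cast ht.2.1)
    unfold HlipQ
    push_cast
    have : (0 : ℝ) ≤ |(t.c : ℝ)| := abs_nonneg _
    nlinarith

/-- **`H` is Lipschitz** with constant `HlipQ`. [folklore] -/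
theorem Hval_sub_le {N : ℕ} (hok : FI.logTableOK N = true) :
    ∀ (hl : List HTerm), (∀ t ∈ hl, (1 ≤ t.p ∧ t.p ≤ N) ∧ (1 ≤ t.q ∧ t.q ≤ N)) → ∀ y u : ℝ,
      Hval hl y - Hval hl u ≤ (HlipQ (FI.logTable N) hl : ℝ) * |y - u|
  | [], _, y, u => by simp [Hval, HlipQ]
  | t :: rest, hl, y, u => by
    have ht := hl t (by simp)
    have ih := Hval_sub_le hok rest (fun s hs => hl s (by simp [hs])) y u
    unfold Hval at ih ⊢
    unfold HlipQ
    simp only [List.map_cons, List.sum_cons]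
    push_cast
    have hp0 : 0 ≤ Real.log t.p := Real.log_nonneg (by exact_mod_cast ht.1.1)
    have hq0 : 0 ≤ Real.log t.q := Real.log_nonneg (by exact_mod_cast ht.2.1)
    have hp1 : Real.log t.p ≤ (((FI.logTable N).getD t.p (FI.ofInt 0)).hiQ : ℝ) :=
      FI.le_hiQ (FI.mem_logTable hok ht.1.2)
    have hq1 : Real.log t.q ≤ (((FI.logTable N).getD t.q (FI.ofInt 0)).hiQ : ℝ) :=
      FI.le_hiQ (FI.mem_logTable hok ht.2.2)
    have hL : |Real.log t.p - Real.log t.q| ≤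
        (((FI.logTable N).getD t.p (FI.ofInt 0)).hiQ : ℝ) + (((FI.logTable N).getD t.q (FI.ofInt 0)).hiQ : ℝ) := by
      rw [abs_le]; constructor <;> linarith
    have hc := Real.abs_cos_sub_cos_le (y * (Real.log t.p - Real.log t.q)) (u * (Real.log t.p - Real.log t.q))
    rw [← sub_mul, abs_mul] at hc
    have h1 : (t.c : ℝ) * Real.cos (y * (Real.log t.p - Real.log t.q)) -
        (t.c : ℝ) * Real.cos (u * (Real.log t.p - Real.log t.q)) ≤
        |(t.c : ℝ)| * ((((FI.logTable N).getD t.p (FI.ofInt 0)).hiQ : ℝ) +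
          (((FI.logTable N).getD t.q (FI.ofInt 0)).hiQ : ℝ)) * |y - u| := by
      rw [← mul_sub]
      refine (le_abs_self _).trans ?_
      rw [abs_mul, mul_assoc]
      refine mul_le_mul_of_nonneg_left (hc.trans ?_) (abs_nonneg _)
      rw [mul_comm]
      exact mul_le_mul_of_nonneg_right hL (abs_nonneg _)
    nlinarith [ih, h1]

end PW

/-! ## The correction read off an SOS certificate -/

namespace SOSData

variable (Z : SOSData)

/-- The out-of-window classes of the certificate as a list of correction terms. [folklore] -/
def hlist : List HTerm :=
  (List.range Z.Np).flatMap fun p' => (List.range Z.Np).flatMap fun q' =>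
    if Nat.Coprime (p' + 1) (q' + 1) ∧ Z.isOut (p' + 1) (q' + 1) = true then
      [⟨p' + 1, q' + 1, Z.classSum (p' + 1) (q' + 1) / 4 ^ Z.S⟩] else []

/-- `Hval Z.hlist = Z.Hsos`. [folklore] -/
theorem Hval_hlist (y : ℝ) : Hval Z.hlist y = Z.Hsos y := by
  classical
  unfold Hval hlist Hsos ratioClasses
  rw [Finset.sum_filter, Finset.sum_product, ← Finset.Ico_add_one_right_eq_Icc, Finset.sum_Ico_eq_sum_range,
    List.flatMap_def, List.map_flatten, List.sum_flatten, List.map_map, List.map_map,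
    ← List.sum_toFinset _ (List.nodup_range), List.toFinset_range]
  refine Finset.sum_congr (by simp) fun p' _ => ?_
  simp only [Function.comp_apply]
  rw [Finset.sum_Ico_eq_sum_range, List.flatMap_def, List.map_flatten, List.sum_flatten, List.map_map,
    List.map_map, ← List.sum_toFinset _ (List.nodup_range), List.toFinset_range]
  refine Finset.sum_congr (by simp) fun q' _ => ?_
  simp only [Function.comp_apply]
  rw [Nat.add_comm 1 p', Nat.add_comm 1 q']
  by_cases hc : Nat.Coprime (p' + 1) (q' + 1) ∧ Z.isOut (p' + 1) (q' + 1) = true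
  · rw [if_pos hc, if_pos hc.1, if_pos hc.2]
    simp
  · rw [if_neg hc]
    simp only [List.map_nil, List.sum_nil]
    by_cases h1 : Nat.Coprime (p' + 1) (q' + 1)
    · rw [if_pos h1, if_neg (fun h2 => hc ⟨h1, h2⟩)]
    · rw [if_neg h1]

/-- Entries of `hlist` lie in `[1, Np]`. [folklore] -/
theorem mem_hlist {t : HTerm} (ht : t ∈ Z.hlist) : (1 ≤ t.p ∧ t.p ≤ Z.Np) ∧ (1 ≤ t.q ∧ t.q ≤ Z.Np) := by
  unfold hlist at ht
  simp only [List.mem_flatMap, List.mem_range] at ht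
  obtain ⟨p', hp', q', hq', hm⟩ := ht
  split at hm
  · simp only [List.mem_singleton] at hm
    subst hm
    exact ⟨⟨Nat.succ_pos _, by show p' + 1 ≤ Z.Np; omega⟩, Nat.succ_pos _, by show q' + 1 ≤ Z.Np; omega⟩
  · simp at hm

end SOSData

/-! ## The checker with `H` -/

namespace PWData

section Defs

variable (D : PWData)

/-- Point bound of `F_D + H` at `u`: `flT + H_lo(u)`. [folklore] -/
def flTH (cs : List (FI × FI)) (logs : List FI) (hl : List HTerm) (w u : ℚ) : Option ℚ :=
  (D.flT cs logs w u).map fun f => f + (PW.HFI hl logs u).loQ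

/-- Two-point cells for `F_D + H` with slope constant `S`. [folklore] -/
def checkGridFromH (cs : List (FI × FI)) (logs : List FI) (hl : List HTerm) (S w : ℚ) : ℚ → ℚ → List ℚ → Bool
  | _, _, [] => true
  | u, fu, v :: rest =>
    match D.flTH cs logs hl w v with
    | some fv => decide (u ≤ v) && decide ((v - u) * S ≤ fu + fv) && checkGridFromH cs logs hl S w v fv rest
    | none => false

/-- A grid passes for `F_D + H`. [folklore] -/
def checkGrid₂H (cs : List (FI × FI)) (logs : List FI) (hl : List HTerm) (S w : ℚ) : List ℚ → Bool
  | [] => false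
  | u :: rest =>
    match D.flTH cs logs hl w u with
    | some fu => D.checkGridFromH cs logs hl S w u fu rest
    | none => false

/-- The slope constant of `F_D + H`. [folklore] -/
def slopeH (logs : List FI) (hl : List HTerm) : ℚ := D.slope + PW.HlipQ logs hl

/-- An anchored grid passes for `F_D + H`. [folklore] -/
def checkAGrid₂H (cs : List (FI × FI)) (logs : List FI) (hl : List HTerm) (g : ℚ × List ℚ) : Bool :=
  match g.2 with
  | [] => false
  | u :: _ => decide (g.1 ≤ wLoQ D.prec u (D.mwAt u)) && D.checkGrid₂H cs logs hl (D.slopeH logs hl) g.1 g.2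

/-- The correction list is the certificate's, and its indices are covered by the log table. [folklore] -/
def checkHTerms (Z : SOSData) (hl : List HTerm) : Bool :=
  decide (hl = Z.hlist) && decide (Z.Np ≤ D.logN)

/-- **The SOS tail check**: beyond `Y₀`, `Re ψ(Y₀) − log π + s − decay/(¼ + Y₀²) − sosBound ≥ 0`. [folklore] -/
def checkTailH (Z : SOSData) (Y0 : ℚ) : Bool :=
  Z.checkSOS D.nodeList D.d.L &&
    decide (0 ≤ wLoQ D.prec Y0 D.mwT - logPiHi + D.s - Z.sosBound D.nodeList D.a - D.decayFI.hiQ / (1 / 4 + Y0 * Y0))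

end Defs

end PWData

end Summit.RiemannHypothesis.RiemannHypothesis.Theorems.SignCone

end
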